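import Summits.KontsevichZagierPeriods.KontsevichZagierPeriods.Theorems.SoloBlindPowerRegion
import Summits.KontsevichZagierPeriods.KontsevichZagierPeriods.Theorems.SoloBlindLemniscateLine
import HarnessLib

/-!
# Lamé quadrants: `{xⁿ + yⁿ ≤ 1}` is `(1/2n)·β(1/n,1/n)` inside the rules

For `n = k+1 ≥ 1` the quadrant of the Lamé (Fermat) curve `xⁿ + yⁿ = 1`,

  `L_n = {(x,y) | 0 < x < 1, 0 ≤ y, yⁿ ≤ 1 - xⁿ}`,

is a `ℚ`-rational region with curved boundary.  Three KZ moves and one Beta translation compute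
its class: Newton–Leibniz to `[(0,1), (1-xⁿ)^{1/n} dx]`, the polynomial chart `u = xⁿ` to
`(1/n)·β(1/n, 1/n + 1)`, and the translation `β(a,a+1) = ½β(a,a)` (integration by parts inside the
rules, `betaQ_transl`).  Hence

* **`[L_n] = (1/2n)•β(1/n,1/n)`** (`mkQ_lameRegion`) and the classical area formula
  `area(L_n) = Γ(1/n)²/(2n·Γ(2/n))`, read off from the moves (`lameRegion_value`);
* **`L_n ≡ (1/2n)·[(0,1), (u(1-u))^{1/n-1} du]`** (`kz_lameRegion_beta`), an explicit equivalence of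
  a two-dimensional rational region with a one-dimensional Euler integral;
* `n = 2`: the quarter disc has class `¼x_π` (`mkQ_lameRegion_one`), so it lies in the cell span and
  the Kontsevich–Zagier conjecture holds for it against all of `V` (`kz_quarterDisc`); `n = 1`
  is the triangle `½•1`.

For `n = 3, 4` the classes `(1/6)β(⅓,⅓)`, `(1/8)β(¼,¼)` are the generators of the equianharmonic
and lemniscatic sectors (`SoloBlindFermatCubic`, `SoloBlindEllipticRegions`); this file is the
uniform statement for all `n`.

References: Kontsevich–Zagier, *Periods* (2001), §1.1–1.2. -/

noncomputable section

namespace Summit.KontsevichZagierPeriods.KontsevichZagierPeriods.Theorems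

open Set MeasureTheory
open Literature.ModelTheory.ExponentialFields (IsSemialgebraic)
open MvPolynomial (aeval X C)
open Literature.NumberTheory.Transcendental
open Literature.NumberTheory.Transcendental.KZ

namespace SoloBlind

variable (k : ℕ)

/-- The exponent `1/n`, `n = k+1`. -/
def lameExp : ℚ := 1 / ((k:ℚ) + 1)

/-- `0 < 1/n`. -/
theorem lameExp_pos : 0 < lameExp k := by rw [lameExp]; positivity

/-- `0 ≤ 1/n` in `ℝ`. -/
theorem lameExp_nonneg : (0:ℝ) ≤ ((lameExp k : ℚ) : ℝ) := by exact_mod_cast (lameExp_pos k).le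

/-- `(1/n)·n = 1` in `ℝ`. -/
theorem lameExp_mul : ((lameExp k : ℚ) : ℝ) * ((k:ℝ) + 1) = 1 := by
  rw [lameExp]; push_cast; field_simp

/-- `λ(x) = (1 - xⁿ)^{1/n}`. -/
def lameF (x : ℝ) : ℝ := (1 - x ^ (k + 1)) ^ (((lameExp k : ℚ)) : ℝ)

/-- `0 ≤ λ(x)` when `xⁿ ≤ 1`. -/
theorem lameF_nonneg {x : ℝ} (hx : 0 ≤ 1 - x ^ (k + 1)) : 0 ≤ lameF k x := Real.rpow_nonneg hx _

/-- `λ(x)ⁿ = 1 - xⁿ` when `xⁿ ≤ 1`. -/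
theorem lameF_pow {x : ℝ} (hx : 0 ≤ 1 - x ^ (k + 1)) : lameF k x ^ (k + 1) = 1 - x ^ (k + 1) := by
  rw [lameF, ← Real.rpow_natCast, ← Real.rpow_mul hx, Nat.cast_succ, lameExp_mul, Real.rpow_one]

/-- `λ` is continuous. -/
theorem continuous_lameF : Continuous (lameF k) :=
  (continuous_const.sub (continuous_pow (k + 1))).rpow_const fun _ => Or.inr (lameExp_nonneg k)

/-- `λ` is integrable on `(0,1)`. -/
theorem integrableOn_lameF : IntegrableOn (lameF k) (Ioo 0 1) :=
  ((continuous_lameF k).continuousOn.integrableOn_Icc (μ := volume)).mono_set Ioo_subset_Icc_self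

/-- `λ` is `ℚ`-semialgebraic on `(0,1)` (an Euler–Mellin integrand). -/
theorem isSemialgebraicFunOn_lameF :
    IsSemialgebraicFunOn ℚ (line (Ioo 0 1)) (fun x : Fin 1 → ℝ => lameF k (x 0)) := by
  have h := isSemialgebraicFunOn_mellinIntegrand
    (isSemialgebraic_line_Ioo isAlgebraic_zero isAlgebraic_one)
    ![(1 - X 0 ^ (k + 1) : MvPolynomial (Fin 1) ℚ)] ![lameExp k] 1 (fun x hx j => by
      have hx' : x 0 ∈ Ioo (0:ℝ) 1 := mem_line.mp hx
      simpa using sub_pos.mpr (pow_lt_one₀ hx'.1.le hx'.2 k.succ_ne_zero))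
  refine h.congr fun x _ => ?_
  simp only [mellinIntegrand_apply, Fin.prod_univ_one, Matrix.cons_val_fin_one, map_sub, map_one,
    map_pow, MvPolynomial.aeval_X, lameF]
  push_cast
  ring

/-- **`[(0,1), (1-xⁿ)^{1/n} dx]`.** -/
def lame1 : IntegralRep 1 :=
  lineRep (Ioo 0 1) (lameF k) (isSemialgebraic_line_Ioo isAlgebraic_zero isAlgebraic_one)
    (isSemialgebraicFunOn_lameF k) (integrableOn_lameF k)

/-! ## The quadrant `L_n` -/

/-- `L_n = {0 < x < 1, 0 ≤ y, yⁿ ≤ 1 - xⁿ}`. -/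
def kzLame : Set (Fin 2 → ℝ) :=
  {z | (0 < z 0 ∧ z 0 < 1) ∧ 0 ≤ z 1 ∧ z 1 ^ (k + 1) ≤ 1 - z 0 ^ (k + 1)}

/-- `L_n` is `ℚ`-semialgebraic. -/
theorem isSemialgebraic_kzLame : IsSemialgebraic ℚ (kzLame k) := by
  convert isSemialgebraic_subgraph (X 1 ^ (k + 1)) (1 - X 0 ^ (k + 1)) using 1
  ext z
  simp [kzLame]

/-- `L_n` is the region under the graph of `λ`. -/
theorem kzLame_eq : kzLame k = {z | (0 < z 0 ∧ z 0 < 1) ∧ 0 ≤ z 1 ∧ z 1 ≤ lameF k (z 0)} := by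
  ext z
  simp only [kzLame, mem_setOf_eq]
  refine and_congr_right fun hx => and_congr_right fun hy => ?_
  have h1 := (sub_pos.mpr (pow_lt_one₀ hx.1.le hx.2 k.succ_ne_zero)).le
  rw [← pow_le_pow_iff_left₀ hy (lameF_nonneg k h1) k.succ_ne_zero, lameF_pow k h1]

/-- `L_n` lies in the unit square. -/
theorem kzLame_subset : kzLame k ⊆ Icc 0 1 := subset_Icc_of_le_one fun z hz => by
  obtain ⟨hx, hy, h⟩ := hz
  refine ⟨hx, hy, ?_⟩
  have h1 : z 1 ^ (k + 1) ≤ 1 := h.trans (sub_le_self _ (pow_nonneg hx.1.le _))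
  exact (pow_le_one_iff_of_nonneg hy k.succ_ne_zero).mp h1

/-- **`L_n = [{0<x<1, 0≤y, yⁿ ≤ 1-xⁿ}, 1]`**, with `ℚ`-rational data. -/
def lameRegion : IntegralRep 2 :=
  ratRep (kzLame k) (fun _ => 1) 1 1 (isSemialgebraic_kzLame k) (fun _ _ => by simp)
    (fun _ _ => by simp) (integrableOn_one_of_subset_Icc (kzLame_subset k))

/-- `L_n` has KZ's literal rational shape. -/
theorem isRational_lameRegion : (lameRegion k).IsRational := isRational_ratRep

/-- **Move (Newton–Leibniz): `L_n ≡ [(0,1), (1-xⁿ)^{1/n} dx]`.** -/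
theorem lameRegion_sub_lame1 : of (lameRegion k) - of (lame1 k) ∈ relations :=
  subgraph_sub_lineRep (lameRegion k)
    (fun _ hx => lameF_nonneg k (sub_pos.mpr (pow_lt_one₀ hx.1.le hx.2 k.succ_ne_zero)).le)
    (kzLame_eq k) rfl

/-! ## The chart `u = xⁿ` onto the Euler integral -/

/-- The Beta representation `(1/n)·β(1/n, 1/n+1) = [(0,1), (1/n) u^{1/n-1}(1-u)^{1/n} du]`. -/
def lameBeta : IntegralRep 1 :=
  (betaRep (lameExp k) (lameExp k + 1) (lameExp_pos k) (add_pos (lameExp_pos k) one_pos)).constMul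
    ((lameExp k : ℚ) : ℝ) (isAlgebraic_rat ℚ _)

variable {k} in
/-- `(xⁿ)^{1/n-1} · xᵏ = 1` for `x > 0`. -/
theorem pow_succ_rpow_mul_pow {x : ℝ} (hx : 0 < x) :
    (x ^ (k + 1)) ^ (((lameExp k : ℚ) : ℝ) - 1) * x ^ k = 1 := by
  rw [← Real.rpow_natCast x (k + 1), ← Real.rpow_mul hx.le, Nat.cast_succ,
    show ((k:ℝ) + 1) * (((lameExp k : ℚ) : ℝ) - 1) = -(k:ℝ) by
      rw [mul_sub, mul_comm _ (((lameExp k : ℚ) : ℝ)), lameExp_mul]; ring,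
    Real.rpow_neg hx.le, Real.rpow_natCast, inv_mul_cancel₀ (pow_pos hx k).ne']

variable {k} in
/-- Pull-back: `λ(x) = (1/n)·((xⁿ)^{1/n-1}(1-xⁿ)^{1/n}) · |n xᵏ|`. -/
theorem lameF_pullback {x : ℝ} (hx : x ∈ Ioo (0:ℝ) 1) :
    lameF k x = ((lameExp k : ℚ) : ℝ) * ((x ^ (k + 1)) ^ (((lameExp k : ℚ) : ℝ) - 1) *
        (1 - x ^ (k + 1)) ^ ((((lameExp k + 1 : ℚ)) : ℝ) - 1)) * |((k:ℕ) + 1 : ℝ) * x ^ k| := by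
  have h0 := hx.1
  have hk : (0:ℝ) < (k:ℝ) + 1 := by positivity
  rw [abs_of_pos (by positivity), show ((((lameExp k + 1 : ℚ)) : ℝ) - 1) = ((lameExp k : ℚ) : ℝ)
    by push_cast; ring]
  calc lameF k x = lameF k x * (((x ^ (k + 1)) ^ (((lameExp k : ℚ) : ℝ) - 1) * x ^ k)) *
      (((lameExp k : ℚ) : ℝ) * ((k:ℝ) + 1)) := by rw [pow_succ_rpow_mul_pow h0, lameExp_mul]; ring
    _ = _ := by rw [lameF]; ring

/-- **Move (`u = xⁿ`): `[(0,1), (1-xⁿ)^{1/n} dx] ≡ (1/n)·β(1/n, 1/n+1)`.** -/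
theorem lame1_sub_lameBeta : of (lame1 k) - of (lameBeta k) ∈ relations := by
  rw [lameBeta, betaRep_constMul_eq_lineRep]
  unfold lame1
  exact lineRep_subst (fun x : ℝ => x ^ (k + 1)) (fun t => ((k:ℕ) + 1 : ℝ) * t ^ k)
    (isSemialgebraicFunOn_pow_succ k)
    (fun t _ => by simpa using (hasDerivAt_pow (k + 1) t).hasDerivWithinAt) (injOn_pow_succ k)
    (image_pow_succ k) (fun t ht => lameF_pullback ht)

/-- `[(1/n)·β(1/n,1/n+1)] = (1/n)•β(1/n,1/n+1)` in `Q`. -/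
theorem mkQ_lameBeta :
    mkQ (of (lameBeta k)) = ((lameExp k : ℚ) : K₀) • betaQ (lameExp k) (lameExp k + 1) := by
  rw [lameBeta, mkQ_constMul_ratCast, betaQ_eq]

/-- **Translation `β(a,a+1) = ½β(a,a)`** (integration by parts inside the rules). -/
theorem betaQ_self_succ {a : ℚ} (ha : 0 < a) :
    betaQ a (a + 1) = (((1:ℚ) / 2 : ℚ) : K₀) • betaQ a a := by
  have h := betaQ_transl (a := a) (b := a) ha ha
  have hne : (a + a : ℚ) ≠ 0 := by positivity
  have h2 := congrArg (fun q : Q => (((a + a)⁻¹ : ℚ) : K₀) • q) h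
  simp only [smul_smul, ← Rat.cast_mul, inv_mul_cancel₀ hne, Rat.cast_one, one_smul] at h2
  rw [h2, show ((a + a)⁻¹ * a : ℚ) = 1 / 2 by field_simp; ring]

/-! ## The class and the area of `L_n` -/

/-- **`[L_n] = (1/2n)•β(1/n,1/n)`** in `Q`: three moves and a translation. -/
theorem mkQ_lameRegion :
    mkQ (of (lameRegion k)) = ((lameExp k / 2 : ℚ) : K₀) • betaQ (lameExp k) (lameExp k) := by
  have h : mkQ (of (lameRegion k)) = mkQ (of (lameBeta k)) := by
    rw [mkQ_eq_mkQ_iff, ← sub_add_sub_cancel _ (of (lame1 k)) _]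
    exact relations.add_mem (lameRegion_sub_lame1 k) (lame1_sub_lameBeta k)
  rw [h, mkQ_lameBeta, betaQ_self_succ (lameExp_pos k), smul_smul, ← Rat.cast_mul]
  congr 1
  push_cast
  ring

/-- **`area(L_n) = Γ(1/n)² / (2n·Γ(2/n))`**, read off from the moves. -/
theorem lameRegion_value :
    (lameRegion k).value = ((lameExp k : ℚ) : ℝ) / 2 * (Real.Gamma (lameExp k) *
      Real.Gamma (lameExp k) / Real.Gamma ((lameExp k : ℚ) + lameExp k)) := by
  have h := congrArg evalQ (mkQ_lameRegion k)
  rw [evalQ_mkQ, eval_of, evalQ_smul, evalQ_betaQ (lameExp_pos k) (lameExp_pos k),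
    coe_ratCast_K₀] at h
  rw [h]
  push_cast
  ring

/-- **`L_n ≡ (1/2n)·β(1/n,1/n)`**: the Lamé quadrant and the scaled symmetric Euler integral
`[(0,1), (1/2n)(u(1-u))^{1/n-1} du]` are equivalent under the Kontsevich–Zagier moves. -/
theorem kz_lameRegion_beta :
    Equivalent (lameRegion k) ((betaRep (lameExp k) (lameExp k) (lameExp_pos k)
      (lameExp_pos k)).constMul ((lameExp k / 2 : ℚ) : ℝ) (isAlgebraic_rat ℚ _)) := by
  rw [Equivalent, ← mkQ_eq_mkQ_iff, mkQ_lameRegion, mkQ_constMul_ratCast,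
    betaQ_eq (lameExp_pos k) (lameExp_pos k)]

/-! ## `n = 2`: the quarter disc -/

/-- `1/n = ½` for `n = 2`. -/
theorem lameExp_one : lameExp 1 = 1 / 2 := by rw [lameExp]; norm_num

/-- **`[quarter disc] = ¼x_π`** in `Q` (`β(½,½) = x_π` inside the rules). -/
theorem mkQ_lameRegion_one : mkQ (of (lameRegion 1)) = (((1:ℚ) / 4 : ℚ) : K₀) • xPi := by
  rw [mkQ_lameRegion, lameExp_one, betaQ_half_half]
  norm_num

/-- The quarter disc `{0<x<1, 0≤y, y² ≤ 1-x²}` lies in the cell span `V`. -/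
theorem mkQ_lameRegion_one_mem_cellSpan : mkQ (of (lameRegion 1)) ∈ cellSpan := by
  rw [mkQ_lameRegion_one]
  exact Submodule.smul_mem _ _ xPi_mem_cellSpan

/-- `area(quarter disc) = π/4`, from the class. -/
theorem lameRegion_one_value : (lameRegion 1).value = Real.pi / 4 := by
  have h := congrArg evalQ (mkQ_lameRegion_one)
  rw [evalQ_mkQ, eval_of, evalQ_smul, evalQ_xPi, coe_ratCast_K₀] at h
  rw [h]
  push_cast
  ring

/-- **The Kontsevich–Zagier conjecture for the quarter disc** `{x² + y² ≤ 1, x > 0, y ≥ 0}`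
against every representation with class in `V` (Baker). -/
theorem kz_quarterDisc {d : ℕ} (r' : IntegralRep d) (hr' : mkQ (of r') ∈ cellSpan)
    (hv : (lameRegion 1).value = r'.value) : Equivalent (lameRegion 1) r' := by
  rw [Equivalent, ← mkQ_eq_mkQ_iff, ← sub_eq_zero]
  exact eq_zero_of_mem_cellSpan (sub_mem mkQ_lameRegion_one_mem_cellSpan hr')
    (by rw [map_sub, evalQ_mkQ, evalQ_mkQ, eval_of, eval_of, hv, sub_self])

end SoloBlind

end Summit.KontsevichZagierPeriods.KontsevichZagierPeriods.Theorems
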